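import Mathlib.LinearAlgebra.Matrix.Notation
import Mathlib.Data.Matrix.Mul
import Mathlib.Algebra.Group.Pi.Lemmas
import HarnessLib

/-!
# Hecke operators supported on the old part act through `M₂(R)·u` — the `i†i = u` argument (cell `b2b-bsdres`, seat additive-p4 gen 34, line V58 — K105 = Lemma L1 of memo V58, abstract core)

HONEST FRAMING (verbatim, cell `b2b-bsdres`): the goal of the cell is to DELETE the COMBINATION-SHAPED
residual classes for ALL analytic-rank `≤ 1` curves over `ℚ` — "full BSD formula for every rank `≤ 1`
curve in class `C`" assembled STRICTLY from published theorems — so that the rank-`≤ 1` remainder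
becomes exactly the CONSTRUCTION-SHAPED classes, which are TYPED (missing-input Props), NOT attempted;
this is not "finishing BSD". This file: PURE ALGEBRA (additive maps and 2×2 matrices; no arithmetic
input, no conjecture, nothing booked; 0 defs). It machine-checks the abstract core ("Lemma L1") of the
seat's proof sketch (memo V58) that the two-prime old-space exactness T-V54 follows from multiplicity one.

## The argument (Ribet 1990 §3 / Diamond–Taylor–Wiles, for the Brandt module of a definite quaternion algebra)

`H′` = a Hecke module of level `Mℓ` (an additive group), `H = R` free of rank one over the level-`M`
Hecke algebra `R` (multiplicity one), so the two degeneracy maps give `i : R² → H′`; `i† : H′ → R²`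
is the adjoint for perfect Hecke-compatible pairings, `i† ∘ i = u` (the Gram matrix), `i†` is SURJECTIVE
(⟸ Ihara: `i ⊗ 𝔽_p` injective), and a Hecke operator `t` SUPPORTED ON THE OLD PART satisfies
`t(H′) ⊆ i(R²)` (⟸ Ihara: `i(R²)` saturated). If `t` acts on `R²` through the adjoint matrix `t₂′`
(`i† ∘ t = t₂′ ∘ i†`), then `t₂′ = u·C` for some `C ∈ M₂(R)` (`oldSupported_adjointAction_eq_gram_mul`),
hence `t₂′ᵀ = Cᵀ·u` when `u` is symmetric (`oldSupported_action_mem_gramIdeal`): the action of `t` on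
the old plane lies in `M₂(R)·u`, which `X4/LevelRaisingCongruenceIdeal.lean` (K104) identifies with
the principal ideal `(𝒰² − 1)` when the action is through `R[𝒰]`. No injectivity of `i`, no ring
structure on `H′`, and no hypothesis on `R` are needed for this step.

## References

* K. A. Ribet, Invent. Math. 100 (1990) 431–476, §3 ((3.10)–(3.15)) and (6.1). [cite: Ribet1990, §3, (6.1)]
* K. A. Ribet, Proc. ICM 1983 (1984), Thm. 4.1 (Ihara's lemma). [cite: Ribet1984ICM, Thm. 4.1]
* F. Diamond, "The refined conjecture of Serre" (Hong Kong 1993 volume), §§3–4. [cite: Diamond1995RefinedSerre, §§3–4]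
-/

namespace Summit.BirchSwinnertonDyer.Rank1Residual.LevelLowering

open Matrix

section OldSupported

variable {R : Type*} [CommRing R] {H' : Type*} [AddCommGroup H']

/-- **Lemma L1 (memo V58), adjoint form.** Let `i : R² → H′` (degeneracy maps), `idag : H′ → R²` (its
adjoint) with `idag ∘ i = u` (Gram matrix), `idag` surjective (dual Ihara), and let `t : H′ → H′` be
supported on the old part in the saturated sense `t(H′) ⊆ i(R²)` (Ihara), acting on `R²` through the
adjoint matrix `t₂′` (`idag ∘ t = t₂′ ∘ idag`). Then `t₂′ = u · C` for some `C ∈ M₂(R)`.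
[cite: Ribet1990, §3, (6.1)] [cite: Ribet1984ICM, Thm. 4.1] -/
theorem oldSupported_adjointAction_eq_gram_mul
    (i : (Fin 2 → R) →+ H') (idag : H' →+ (Fin 2 → R)) (t : H' →+ H')
    (u t₂' : Matrix (Fin 2) (Fin 2) R)
    (hu : ∀ v, idag (i v) = u.mulVec v)
    (hadj : ∀ h, idag (t h) = t₂'.mulVec (idag h))
    (hsat : ∀ h, ∃ v, t h = i v)
    (hsurj : Function.Surjective idag) :
    ∃ C : Matrix (Fin 2) (Fin 2) R, t₂' = u * C := by
  classical
  -- for each basis vector `e_j` choose `h_j` with `idag h_j = e_j` and `v_j` with `t h_j = i v_j`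
  choose h hh using fun j : Fin 2 => hsurj (Pi.single j 1)
  choose v hv using fun j : Fin 2 => hsat (h j)
  refine ⟨Matrix.of fun k j => v j k, ?_⟩
  -- compare the two matrices on basis vectors: column `j` of `t₂'` is `u.mulVec (v j)`
  have hcol : ∀ j, t₂'.mulVec (Pi.single j 1) = u.mulVec (v j) := fun j => by
    rw [← hh j, ← hadj, hv j, hu]
  ext k j
  have h1 := congrFun (hcol j) k
  simp only [Matrix.mulVec, dotProduct, Pi.single_apply, mul_ite, mul_one, mul_zero,
    Finset.sum_ite_eq', Finset.mem_univ, if_true] at h1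
  rw [h1, Matrix.mul_apply]
  rfl

/-- **Lemma L1 (memo V58), action form.** In the situation of
`oldSupported_adjointAction_eq_gram_mul`, if the Gram matrix `u` is symmetric then the transposed
matrix `t₂'ᵀ` — the action of `t` on the old plane `R²` when the pairings are `𝕋`-bilinear — is a
left `M₂(R)`-multiple of `u`: `t₂'ᵀ ∈ M₂(R)·u`. Combined with `levelRaisingIdeal_iff(_brandt)` of
`X4/LevelRaisingCongruenceIdeal.lean` (when the action is through `R[𝒰]`) this gives Ribet's
level-raising congruence identity `t|_old ∈ (𝒰² − 1)`. [cite: Ribet1990, §3, (6.1)]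
[cite: Diamond1995RefinedSerre, §§3–4] -/
theorem oldSupported_action_mem_gramIdeal
    (i : (Fin 2 → R) →+ H') (idag : H' →+ (Fin 2 → R)) (t : H' →+ H')
    (u t₂' : Matrix (Fin 2) (Fin 2) R) (husymm : u.transpose = u)
    (hu : ∀ v, idag (i v) = u.mulVec v)
    (hadj : ∀ h, idag (t h) = t₂'.mulVec (idag h))
    (hsat : ∀ h, ∃ v, t h = i v)
    (hsurj : Function.Surjective idag) :
    ∃ m : Matrix (Fin 2) (Fin 2) R, t₂'.transpose = m * u := by
  obtain ⟨C, hC⟩ := oldSupported_adjointAction_eq_gram_mul i idag t u t₂' hu hadj hsat hsurj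
  refine ⟨C.transpose, ?_⟩
  rw [hC, Matrix.transpose_mul, husymm]

end OldSupported

end Summit.BirchSwinnertonDyer.Rank1Residual.LevelLowering
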